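import Mathlib.RingTheory.MvPolynomial.WeightedHomogeneous
import HarnessLib

/-!
# Barrier (Schanuel) `NesterenkoModularScope`: weighted components and the scaling of isobaric polynomials (toward Mahler's theorem) — proofs only

`Literature/Barriers/Schanuel/NesterenkoModularScopeMahlerAlgebra.lean` — proofs-only algebraic
preliminaries for the proof of Mahler's theorem (`Mahler1969_ramanujan_algIndep` of
`NesterenkoModularScopeMultiplicity.lean`: `z, P, Q, R` are algebraically independent over `ℂ`).
No new definitions. For a weight `w : σ → ℕ`:

* `sum_range_weightedHomogeneousComponent_eq` — `φ = Σ_{n ≤ wdeg φ} φₙ` (isobaric components);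
* `weightedHomogeneousComponent_top_ne_zero` — the top component of `φ ≠ 0` is non-zero;
* `eval_scale_of_isWeightedHomogeneous` — `φₙ(c^{w₀}x₀, c^{w₁}x₁, …) = cⁿ φₙ(x)` for `φₙ` isobaric
  of weight `n`, and `eval_scale_eq_sum` — `φ(c^{wᵢ}xᵢ) = Σₙ cⁿ φₙ(x)`.

These express how a polynomial relation between `E₂, E₄, E₆` (weights `1, 2, 3` for the factor
`(cτ + d)²`) transforms under `τ ↦ γτ`, `γ ∈ SL₂(ℤ)`.

## References

* [Mahler1969] K. Mahler, J. Austral. Math. Soc. 10 (1969) 445–450 (proof of Theorem 1: the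
  weights of `f, f', f*`).
* [NesterenkoPhilippon2001] LNM 1752 (2001), Ch. 1 §1 (D. Bertrand), proof of Proposition 1.1 iii)
  ("a standard weight argument").
-/

noncomputable section

open MvPolynomial

namespace Literature.Barriers.Schanuel

variable {σ : Type*} {R : Type*} [CommRing R]

/-! ### Isobaric components -/

/-- A polynomial is the sum of its isobaric components of weight `≤ wdeg`. [folklore] -/
theorem sum_range_weightedHomogeneousComponent_eq (w : σ → ℕ) (φ : MvPolynomial σ R) :
    ∑ n ∈ Finset.range (φ.weightedTotalDegree w + 1), weightedHomogeneousComponent w n φ = φ := by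
  classical
  ext d
  rw [coeff_sum]
  simp only [coeff_weightedHomogeneousComponent]
  rw [Finset.sum_ite_eq]
  split_ifs with h
  · rfl
  · rw [Finset.mem_range, not_lt] at h
    symm
    by_contra hne
    have := le_weightedTotalDegree w (mem_support_iff.mpr hne)
    omega

/-- The top isobaric component of a non-zero polynomial is non-zero. [folklore] -/
theorem weightedHomogeneousComponent_top_ne_zero (w : σ → ℕ) {φ : MvPolynomial σ R}
    (hφ : φ ≠ 0) : weightedHomogeneousComponent w (φ.weightedTotalDegree w) φ ≠ 0 := by
  classical
  have hne : φ.support.Nonempty := by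
    rw [Finset.nonempty_iff_ne_empty, Ne, support_eq_empty]
    exact hφ
  obtain ⟨d, hd, hdeg⟩ := Finset.exists_mem_eq_sup φ.support hne (fun s => Finsupp.weight w s)
  intro h0
  have := congrArg (coeff d) h0
  rw [coeff_weightedHomogeneousComponent, coeff_zero] at this
  rw [if_pos] at this
  · exact (mem_support_iff.mp hd) this
  · rw [weightedTotalDegree]; exact hdeg.symm

/-- The component of weight `N` of a sum of isobaric polynomials. [folklore] -/
theorem weightedHomogeneousComponent_sum_ite {ι : Type*} (w : σ → ℕ) (s : Finset ι)
    (f : ι → MvPolynomial σ R) (deg : ι → ℕ)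
    (h : ∀ i ∈ s, IsWeightedHomogeneous w (f i) (deg i)) (N : ℕ) :
    weightedHomogeneousComponent w N (∑ i ∈ s, f i) = ∑ i ∈ s, if deg i = N then f i else 0 := by
  classical
  rw [map_sum]
  refine Finset.sum_congr rfl fun i hi => ?_
  split_ifs with hN
  · subst hN
    exact (h i hi).weightedHomogeneousComponent_same
  · exact (h i hi).weightedHomogeneousComponent_ne N (fun h' => hN h'.symm)

/-! ### Scaling of isobaric polynomials -/

/-- The weight of an exponent vector as a sum over its support. [folklore] -/
theorem weight_eq_sum_support (w : σ → ℕ) (s : σ →₀ ℕ) :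
    Finsupp.weight w s = ∑ i ∈ s.support, w i * s i := by
  rw [Finsupp.weight_apply, Finsupp.sum]
  exact Finset.sum_congr rfl fun i _ => by rw [smul_eq_mul, mul_comm]

/-- A monomial evaluated at the scaled point `(c^{wᵢ} xᵢ)ᵢ`. [folklore] -/
theorem eval_scale_monomial (w : σ → ℕ) (s : σ →₀ ℕ) (a : R) (c : R) (x : σ → R) :
    eval (fun i => c ^ w i * x i) (monomial s a) = c ^ Finsupp.weight w s * eval x (monomial s a) := by
  classical
  rw [eval_monomial, eval_monomial, weight_eq_sum_support]
  have h : (s.prod fun i e => (c ^ w i * x i) ^ e) =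
      (s.prod fun i e => c ^ (w i * e)) * s.prod fun i e => x i ^ e := by
    rw [← Finsupp.prod_mul]
    exact Finset.prod_congr rfl fun i _ => by simp only [mul_pow, pow_mul]
  rw [h, Finsupp.prod, Finset.prod_pow_eq_pow_sum]
  ring

/-- **Scaling of an isobaric polynomial**: `φ(c^{w₀}x₀, c^{w₁}x₁, …) = cⁿ φ(x)` if `φ` is
`w`-isobaric of weight `n`. [folklore] -/
theorem eval_scale_of_isWeightedHomogeneous (w : σ → ℕ) {φ : MvPolynomial σ R} {n : ℕ}
    (hφ : IsWeightedHomogeneous w φ n) (c : R) (x : σ → R) :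
    eval (fun i => c ^ w i * x i) φ = c ^ n * eval x φ := by
  classical
  conv_lhs => rw [φ.as_sum, map_sum]
  conv_rhs => rw [φ.as_sum, map_sum, Finset.mul_sum]
  refine Finset.sum_congr rfl fun s hs => ?_
  rw [eval_scale_monomial, hφ (mem_support_iff.mp hs)]

/-- **Scaling of an arbitrary polynomial**: `φ(c^{wᵢ}xᵢ) = Σₙ cⁿ φₙ(x)`, `φₙ` the isobaric
components. [folklore] -/
theorem eval_scale_eq_sum (w : σ → ℕ) (φ : MvPolynomial σ R) (c : R) (x : σ → R) :
    eval (fun i => c ^ w i * x i) φ = ∑ n ∈ Finset.range (φ.weightedTotalDegree w + 1),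
      c ^ n * eval x (weightedHomogeneousComponent w n φ) := by
  conv_lhs => rw [← sum_range_weightedHomogeneousComponent_eq w φ, map_sum]
  exact Finset.sum_congr rfl fun n _ =>
    eval_scale_of_isWeightedHomogeneous w (weightedHomogeneousComponent_isWeightedHomogeneous n φ) c x

/-! ### Components and supports -/

/-- The support of a component is contained in the support. [folklore] -/
theorem support_weightedHomogeneousComponent_subset (w : σ → ℕ) (n : ℕ) (φ : MvPolynomial σ R) :
    (weightedHomogeneousComponent w n φ).support ⊆ φ.support := by
  classical
  intro d hd
  rw [mem_support_iff, coeff_weightedHomogeneousComponent] at hd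
  split_ifs at hd with h
  · exact mem_support_iff.mpr hd
  · exact absurd rfl hd

/-- The weighted degree of a component is at most its weight (if non-zero, equal). [folklore] -/
theorem weightedTotalDegree_weightedHomogeneousComponent_le (w : σ → ℕ) (n : ℕ)
    (φ : MvPolynomial σ R) : (weightedHomogeneousComponent w n φ).weightedTotalDegree w ≤ n := by
  classical
  apply Finset.sup_le
  intro d hd
  rw [mem_support_iff, coeff_weightedHomogeneousComponent] at hd
  split_ifs at hd with h
  · exact h.le
  · exact absurd rfl hd

/-- A non-zero isobaric polynomial of weight `n` has weighted degree `n`. [folklore] -/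
theorem weightedTotalDegree_eq_of_isWeightedHomogeneous (w : σ → ℕ) {φ : MvPolynomial σ R} {n : ℕ}
    (hφ : IsWeightedHomogeneous w φ n) (h0 : φ ≠ 0) : φ.weightedTotalDegree w = n := by
  classical
  apply le_antisymm
  · apply Finset.sup_le
    intro d hd
    exact (hφ (mem_support_iff.mp hd)).le
  · obtain ⟨d, hd⟩ := ne_zero_iff.mp h0
    rw [← hφ hd]
    exact le_weightedTotalDegree w (mem_support_iff.mpr hd)

end Literature.Barriers.Schanuel

end
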